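import Literature.Probability.Percolation.SupercriticalIsoperimetricProfileBound
import Literature.Probability.Percolation.SupercriticalIsoperimetricProfile
import Mathlib.Analysis.SpecialFunctions.Pow.Asymptotics
import Mathlib.Analysis.PSeries
import Mathlib.MeasureTheory.OuterMeasure.BorelCantelli
import HarnessLib

/-!
# Isoperimetry of the supercritical cluster (Pete 2008), IV: Corollary 1.3 discharged, with a rate

Topic `Literature/Probability/Percolation`. Theorems only. The discharge
`Pete2008_cor13_holds : Pete2008_cor13` of the named fact of
`SupercriticalIsoperimetricProfile.lean`:

* [Pete2008] G. Pete, *A note on percolation on `ℤ^d`: isoperimetric profile via exponential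
  cluster repulsion*, Electron. Commun. Probab. **13** (2008) 377–392, Corollary 1.3: for
  `p > p_c(ℤ^d)`, `d ≥ 2`, there are `c₃, α > 0` such that a.s., for all large `n`, every
  open-connected `S ⊆ 𝒞_∞ ∩ [-n,n]^d` with `|S| ≥ c₃ (log n)^{d/(d-1)}` has
  `|∂_{𝒞_∞} S| ≥ α |S|^{1-1/d}`.

Proof ("it is deduced there from Theorem 1.2 by Borel–Cantelli"): with the block size `N₀`
and the constants `K, c` of `Pete.real_lowBoundary_le_exp` (part III), put
`N = (2N₀+1)^d`, `a = (d-1)/d`, `α = (2·5^d·d·N^a)⁻¹` and `c₃ = ((d+2)/c)^{1/a}`. If an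
open-connected `S ⊆ [-n,n]^d` with `|S| ≥ M_n = ⌈c₃ (log n)^{d/(d-1)}⌉` has
`|∂_ω S| < α|S|^a`, then `2·5^d |∂_ω S| < (|S|/N)^a/d ≤ m₀(|S|)`, so the low-boundary event of
part III occurs at some anchor `x ∈ [-n,n]^d` with size threshold `M_n`; its probability is at
most `(2n+1)^d K exp(-c M_n^a) ≤ (2n+1)^d K n^{-(d+2)} ≤ 3^d K n^{-2}`. This is the **rate form**
`Pete.exists_real_isoperimetryFails_le` (`P_p`(isoperimetry fails at level `n`) `≤ K' n^{-2}` for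
`n ≥ N₁`), from which Borel–Cantelli (`MeasureTheory.ae_eventually_notMem`) gives Corollary 1.3.
The hypothesis "`S ⊆ 𝒞_∞`" of the printed corollary is not used (the block argument of part III
applies to any open-connected set with few open exits).

## References

* G. Pete, Electron. Commun. Probab. 13 (2008) 377–392, Cor. 1.3 and §3 [Pete2008].
-/

noncomputable section

namespace Literature.Probability.Percolation

namespace Pete

open MeasureTheory LatticeModels SimpleGraph Filter Finset KestenZhang
open scoped ENNReal _root_.Topology

variable {d : ℕ}

/-! ## Real-analysis steps -/

/-- `(2n+1)^d · (n⁻¹)^{d+2} ≤ 3^d · (n⁻¹)^2` for `n ≥ 1`. [folklore] -/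
private theorem poly_mul_inv_pow_le (d : ℕ) {n : ℕ} (hn : 1 ≤ n) :
    ((2 * n + 1 : ℕ) : ℝ) ^ d * ((n : ℝ)⁻¹) ^ (d + 2) ≤ (3 : ℝ) ^ d * ((n : ℝ)⁻¹) ^ 2 := by
  have hn0 : (0 : ℝ) < n := by exact_mod_cast hn
  have h3 : ((2 * n + 1 : ℕ) : ℝ) * (n : ℝ)⁻¹ ≤ 3 := by
    rw [mul_inv_le_iff₀ hn0]
    push_cast
    have : (1 : ℝ) ≤ n := by exact_mod_cast hn
    linarith
  have h0 : (0 : ℝ) ≤ ((2 * n + 1 : ℕ) : ℝ) * (n : ℝ)⁻¹ := by positivity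
  calc ((2 * n + 1 : ℕ) : ℝ) ^ d * ((n : ℝ)⁻¹) ^ (d + 2)
      = (((2 * n + 1 : ℕ) : ℝ) * (n : ℝ)⁻¹) ^ d * ((n : ℝ)⁻¹) ^ 2 := by rw [mul_pow, pow_add]; ring
    _ ≤ (3 : ℝ) ^ d * ((n : ℝ)⁻¹) ^ 2 := by gcongr

/-- `exp(-(k log n)) = (n⁻¹)^k` for `n ≥ 1`. [folklore] -/
private theorem exp_neg_mul_log (k : ℕ) {n : ℕ} (hn : 1 ≤ n) :
    Real.exp (-((k : ℝ) * Real.log n)) = ((n : ℝ)⁻¹) ^ k := by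
  have hn0 : (0 : ℝ) < n := by exact_mod_cast hn
  rw [show -((k : ℝ) * Real.log n) = (k : ℝ) * (-Real.log n) by ring, Real.exp_nat_mul, Real.exp_neg,
    Real.exp_log hn0]

/-! ## The rate form -/

/-- **Pete's in-box isoperimetry with a rate** (proof of Corollary 1.3, quantitative form). For
`d ≥ 2` and `p > p_c(ℤ^d)` there are `c₃, α > 0`, `K` and `N₁` such that for every `n ≥ N₁`,
`P_p(∃ S ⊆ [-n,n]^d` open-connected, `|S| ≥ c₃ (log n)^{d/(d-1)}`, `|∂_ω S| < α|S|^{1-1/d}) ≤ K·n⁻²`,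
where `∂_ω S` is the set of open edges of `ℤ^d` with exactly one endpoint in `S`
(`openEdgeBoundaryCard`). From part III (`real_lowBoundary_le_exp`) by a union over the
`(2n+1)^d` anchors, with `c₃` chosen so that `exp(-c M_n^{(d-1)/d}) ≤ n^{-(d+2)}`.
[cite: Pete2008, Cor. 1.3 (proof, §3)] -/
theorem exists_real_isoperimetryFails_le (hd : 2 ≤ d) (p : unitInterval)
    (hp : criticalProb (zdGraph d) (0 : Site d) < (p : ℝ)) :
    ∃ c₃ α K : ℝ, 0 < c₃ ∧ 0 < α ∧ ∃ N₁ : ℕ, ∀ n : ℕ, N₁ ≤ n →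
      (bondPercolation (zdGraph d) p).real
          {ω : BondConfig (Site d) | ∃ S : Finset (Site d), S ⊆ box d n ∧
            (∀ x ∈ S, ∀ y ∈ S, ω ∈ openConnIn (↑S : Set (Site d)) x y) ∧
            c₃ * Real.log (n : ℝ) ^ ((d : ℝ) / ((d : ℝ) - 1)) ≤ (S.card : ℝ) ∧
            (openEdgeBoundaryCard d ω S : ℝ) < α * (S.card : ℝ) ^ (1 - 1 / (d : ℝ))} ≤
        K * ((n : ℝ)⁻¹) ^ 2 := by
  classical
  have hd0 : d ≠ 0 := by omega
  have hdpos : (0 : ℝ) < d := by exact_mod_cast (by omega : 0 < d)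
  have hd1' : (1 : ℝ) < d := by exact_mod_cast (by omega : 1 < d)
  obtain ⟨N₀, K, c, hc, hB⟩ := real_lowBoundary_le_exp hd p hp
  set μ := bondPercolation (zdGraph d) p with hμ
  -- exponents
  set a : ℝ := ((d : ℝ) - 1) / d with ha
  set b : ℝ := (d : ℝ) / ((d : ℝ) - 1) with hb
  have ha0 : 0 < a := div_pos (by linarith) hdpos
  have hb0 : 0 < b := div_pos hdpos (by linarith)
  have hdne : (d : ℝ) - 1 ≠ 0 := by linarith
  have hba : b * a = 1 := by
    rw [hb, ha]; field_simp
  have ha' : (1 : ℝ) - 1 / d = a := by rw [ha]; field_simp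
  -- constants
  set Nd : ℝ := (2 * N₀ + 1 : ℝ) ^ d with hNd
  have hNd0 : 0 < Nd := by positivity
  set α : ℝ := 1 / (2 * 5 ^ d * ((d : ℝ) * Nd ^ a)) with hα
  have hα0 : 0 < α := by positivity
  set c₃ : ℝ := (((d : ℝ) + 2) / c) ^ a⁻¹ with hc₃
  have hc₃0 : 0 < c₃ := by positivity
  have hc₃a : c₃ ^ a = ((d : ℝ) + 2) / c := by
    rw [hc₃, Real.rpow_inv_rpow (by positivity) ha0.ne']
  -- `K ≥ 0`
  have hK0 : 0 ≤ K := by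
    have h := hB ((bigBox d N₀).card + 1) (by omega) 0
    have he : 0 < Real.exp (-(c * (((bigBox d N₀).card + 1 : ℕ) : ℝ) ^ (((d : ℝ) - 1) / d))) := Real.exp_pos _
    exact (mul_nonneg_iff_of_pos_right he).1 (measureReal_nonneg.trans h)
  -- the size thresholds `M_n`
  set Mn : ℕ → ℕ := fun n => ⌈c₃ * Real.log n ^ b⌉₊ with hMn
  have hMn_ge : ∀ n : ℕ, c₃ * Real.log n ^ b ≤ Mn n := fun n => Nat.le_ceil _
  -- eventually `M_n > |B̃_0|`
  have hev : ∀ᶠ n : ℕ in atTop, ((bigBox d N₀).card : ℝ) + 1 ≤ c₃ * Real.log n ^ b := by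
    have ht : Tendsto (fun n : ℕ => c₃ * Real.log n ^ b) atTop atTop := by
      refine Tendsto.const_mul_atTop hc₃0 ?_
      exact (tendsto_rpow_atTop hb0).comp (Real.tendsto_log_atTop.comp tendsto_natCast_atTop_atTop)
    exact ht.eventually_ge_atTop _
  obtain ⟨N₁, hN₁⟩ := eventually_atTop.1 hev
  have hMn_big : ∀ n : ℕ, N₁ ≤ n → (bigBox d N₀).card < Mn n := by
    intro n hn
    have h := (hN₁ n hn).trans (hMn_ge n)
    exact_mod_cast (by linarith : ((bigBox d N₀).card : ℝ) < Mn n)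
  refine ⟨c₃, α, (3 : ℝ) ^ d * K, hc₃0, hα0, max N₁ 1, fun n hn => ?_⟩
  have hn1 : 1 ≤ n := le_of_max_le_right hn
  have hnN₁ : N₁ ≤ n := le_of_max_le_left hn
  have hn0 : (0 : ℝ) < n := by exact_mod_cast hn1
  have hlog : 0 ≤ Real.log n := Real.log_nonneg (by exact_mod_cast hn1)
  -- the covering sets at level `n`
  set s : Set (BondConfig (Site d)) := ⋃ x ∈ box d n,
    {ω : BondConfig (Site d) | ω ⊆ (zdGraph d).edgeSet ∧ ∃ S : Finset (Site d), x ∈ S ∧ Mn n ≤ #S ∧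
      (∀ y ∈ S, ∀ z ∈ S, ω ∈ openConnIn (↑S : Set (Site d)) y z) ∧
      2 * 5 ^ d * (((edgeBoundary (zdGraph d) S : Finset (Sym2 (Site d))) : Set (Sym2 (Site d))) ∩ ω).ncard ≤
        mZero d N₀ #S} with hs
  -- `exp(-c M_n^a) ≤ (n⁻¹)^{d+2}`
  have hexp : Real.exp (-(c * (Mn n : ℝ) ^ (((d : ℝ) - 1) / d))) ≤ ((n : ℝ)⁻¹) ^ (d + 2) := by
    rw [← exp_neg_mul_log (d + 2) hn1, Real.exp_le_exp, neg_le_neg_iff]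
    have h1 : c₃ ^ a * Real.log n ≤ (Mn n : ℝ) ^ a := by
      have h2 : (c₃ * Real.log n ^ b) ^ a = c₃ ^ a * Real.log n := by
        rw [Real.mul_rpow hc₃0.le (Real.rpow_nonneg hlog _), ← Real.rpow_mul hlog, hba, Real.rpow_one]
      rw [← h2]
      exact Real.rpow_le_rpow (by positivity) (hMn_ge n) ha0.le
    calc ((d + 2 : ℕ) : ℝ) * Real.log n = c * (c₃ ^ a * Real.log n) := by
          rw [hc₃a]; field_simp; push_cast; ring
      _ ≤ c * (Mn n : ℝ) ^ a := mul_le_mul_of_nonneg_left h1 hc.le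
  have hsle : μ.real s ≤ (3 : ℝ) ^ d * K * ((n : ℝ)⁻¹) ^ 2 := by
    calc μ.real s
        ≤ ∑ x ∈ box d n, μ.real {ω : BondConfig (Site d) | ω ⊆ (zdGraph d).edgeSet ∧ ∃ S : Finset (Site d),
            x ∈ S ∧ Mn n ≤ #S ∧ (∀ y ∈ S, ∀ z ∈ S, ω ∈ openConnIn (↑S : Set (Site d)) y z) ∧
            2 * 5 ^ d * (((edgeBoundary (zdGraph d) S : Finset (Sym2 (Site d))) : Set (Sym2 (Site d))) ∩ ω).ncard ≤
              mZero d N₀ #S} := measureReal_biUnion_finset_le _ _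
      _ ≤ ∑ _x ∈ box d n, K * Real.exp (-(c * (Mn n : ℝ) ^ (((d : ℝ) - 1) / d))) :=
          sum_le_sum fun x _ => hB (Mn n) (hMn_big n hnN₁) x
      _ = ((2 * n + 1 : ℕ) : ℝ) ^ d * (K * Real.exp (-(c * (Mn n : ℝ) ^ (((d : ℝ) - 1) / d)))) := by
          rw [sum_const, card_box, nsmul_eq_mul]; push_cast; ring
      _ ≤ ((2 * n + 1 : ℕ) : ℝ) ^ d * (K * ((n : ℝ)⁻¹) ^ (d + 2)) := by gcongr
      _ = K * (((2 * n + 1 : ℕ) : ℝ) ^ d * ((n : ℝ)⁻¹) ^ (d + 2)) := by ring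
      _ ≤ K * ((3 : ℝ) ^ d * ((n : ℝ)⁻¹) ^ 2) := mul_le_mul_of_nonneg_left (poly_mul_inv_pow_le d hn1) hK0
      _ = (3 : ℝ) ^ d * K * ((n : ℝ)⁻¹) ^ 2 := by ring
  -- the failure event at level `n` (intersected with the full-measure lattice event) lies in `s`
  set G : Set (BondConfig (Site d)) := {ω | ω ⊆ (zdGraph d).edgeSet} with hG
  have hGc : μ.real Gᶜ = 0 := by
    have h : μ Gᶜ = 0 := by
      have := ae_subset_edgeSet (zdGraph d) p
      rw [Filter.Eventually, mem_ae_iff] at this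
      exact this
    simp [Measure.real, h]
  have hsub : {ω : BondConfig (Site d) | ∃ S : Finset (Site d), S ⊆ box d n ∧
        (∀ x ∈ S, ∀ y ∈ S, ω ∈ openConnIn (↑S : Set (Site d)) x y) ∧
        c₃ * Real.log (n : ℝ) ^ ((d : ℝ) / ((d : ℝ) - 1)) ≤ (S.card : ℝ) ∧
        (openEdgeBoundaryCard d ω S : ℝ) < α * (S.card : ℝ) ^ (1 - 1 / (d : ℝ))} ∩ G ⊆ s := by
    rintro ω ⟨⟨S, hSbox, hconn, hsize, hlt⟩, hωE⟩
    -- `S` is nonempty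
    rcases S.eq_empty_or_nonempty with hSe | ⟨x, hxS⟩
    · subst hSe
      have hexp0 : (1 : ℝ) - 1 / d ≠ 0 := by rw [ha']; exact ha0.ne'
      simp only [card_empty, Nat.cast_zero, Real.zero_rpow hexp0, mul_zero] at hlt
      exact absurd hlt (not_lt.2 (Nat.cast_nonneg _))
    -- the size threshold
    have hMnS : Mn n ≤ #S := by
      have hsize' : c₃ * Real.log (n : ℝ) ^ b ≤ (#S : ℝ) := hsize
      exact Nat.ceil_le.2 hsize'
    -- the boundary condition `2·5^d |∂_ω S| ≤ m₀(|S|)`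
    have hbd : 2 * 5 ^ d * (((edgeBoundary (zdGraph d) S : Finset (Sym2 (Site d))) : Set (Sym2 (Site d))) ∩ ω).ncard ≤
        mZero d N₀ #S := by
      have h1 : (openEdgeBoundaryCard d ω S : ℝ) < α * (#S : ℝ) ^ a := by rw [← ha']; exact hlt
      have h2 : 2 * 5 ^ d * (α * (#S : ℝ) ^ a) = ((#S : ℝ) / Nd) ^ a / d := by
        rw [hα, Real.div_rpow (Nat.cast_nonneg _) hNd0.le a]
        field_simp
      have h3 : ((#S : ℝ) / Nd) ^ a / d ≤ (mZero d N₀ #S : ℝ) := by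
        have := Nat.le_ceil ((((#S : ℕ) : ℝ) / ((2 * N₀ + 1 : ℝ) ^ d)) ^ (((d : ℝ) - 1) / d) / d)
        rw [hNd, ha]
        exact this
      have h4 : ((2 * 5 ^ d * openEdgeBoundaryCard d ω S : ℕ) : ℝ) < (mZero d N₀ #S : ℝ) := by
        push_cast
        calc (2 : ℝ) * 5 ^ d * (openEdgeBoundaryCard d ω S : ℝ) < 2 * 5 ^ d * (α * (#S : ℝ) ^ a) :=
              mul_lt_mul_of_pos_left h1 (by positivity)
          _ = ((#S : ℝ) / Nd) ^ a / d := h2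
          _ ≤ (mZero d N₀ #S : ℝ) := h3
      have h5 : 2 * 5 ^ d * openEdgeBoundaryCard d ω S < mZero d N₀ #S := by exact_mod_cast h4
      exact h5.le
    rw [hs]
    exact Set.mem_iUnion₂.2 ⟨x, hSbox hxS, hωE, S, hxS, hMnS, hconn, hbd⟩
  calc μ.real {ω : BondConfig (Site d) | ∃ S : Finset (Site d), S ⊆ box d n ∧
          (∀ x ∈ S, ∀ y ∈ S, ω ∈ openConnIn (↑S : Set (Site d)) x y) ∧
          c₃ * Real.log (n : ℝ) ^ ((d : ℝ) / ((d : ℝ) - 1)) ≤ (S.card : ℝ) ∧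
          (openEdgeBoundaryCard d ω S : ℝ) < α * (S.card : ℝ) ^ (1 - 1 / (d : ℝ))}
      ≤ μ.real ({ω : BondConfig (Site d) | ∃ S : Finset (Site d), S ⊆ box d n ∧
          (∀ x ∈ S, ∀ y ∈ S, ω ∈ openConnIn (↑S : Set (Site d)) x y) ∧
          c₃ * Real.log (n : ℝ) ^ ((d : ℝ) / ((d : ℝ) - 1)) ≤ (S.card : ℝ) ∧
          (openEdgeBoundaryCard d ω S : ℝ) < α * (S.card : ℝ) ^ (1 - 1 / (d : ℝ))} ∩ G ∪ Gᶜ) :=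
        measureReal_mono (fun ω hω => by
          by_cases h : ω ∈ G
          · exact Or.inl ⟨hω, h⟩
          · exact Or.inr h) (measure_ne_top _ _)
    _ ≤ μ.real ({ω : BondConfig (Site d) | ∃ S : Finset (Site d), S ⊆ box d n ∧
          (∀ x ∈ S, ∀ y ∈ S, ω ∈ openConnIn (↑S : Set (Site d)) x y) ∧
          c₃ * Real.log (n : ℝ) ^ ((d : ℝ) / ((d : ℝ) - 1)) ≤ (S.card : ℝ) ∧
          (openEdgeBoundaryCard d ω S : ℝ) < α * (S.card : ℝ) ^ (1 - 1 / (d : ℝ))} ∩ G) + μ.real Gᶜ :=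
        measureReal_union_le _ _
    _ ≤ μ.real s + 0 := by rw [hGc]; exact add_le_add (measureReal_mono hsub (measure_ne_top _ _)) le_rfl
    _ ≤ (3 : ℝ) ^ d * K * ((n : ℝ)⁻¹) ^ 2 := by rw [add_zero]; exact hsle

/-- **Pete 2008, Corollary 1.3, discharged** (isoperimetric profile of the supercritical infinite
cluster in a box): for all `d ≥ 2` and `p > p_c(ℤ^d)` there are `c₃, α > 0` such that
`P_p`-a.s. there is `N` with: for all `n > N` and all open-connected `S ⊆ [-n,n]^d` (every two
points of `S` joined by an open path inside `S`) with `|S| ≥ c₃ (log n)^{d/(d-1)}`,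
`α |S|^{1-1/d} ≤ |∂_ω S|`, the number of open edges of `ℤ^d` with exactly one endpoint in `S`.
Proof: the rate form `exists_real_isoperimetryFails_le` (parts I–III) and Borel–Cantelli, as in
Pete's §3; the hypothesis `S ⊆ 𝒞_∞` of the printed statement is not needed.
[cite: Pete2008, Cor. 1.3] -/
theorem Pete2008_cor13_proof : Pete2008_cor13 := by
  intro d hd p hp
  classical
  obtain ⟨c₃, α, K, hc₃0, hα0, N₁, hrate⟩ := exists_real_isoperimetryFails_le hd p hp
  set μ := bondPercolation (zdGraph d) p with hμ
  refine ⟨c₃, α, hc₃0, hα0, ?_⟩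
  -- `K ≥ 0`
  have hK0 : 0 ≤ K := by
    have h := hrate (max N₁ 1) (le_max_left _ _)
    have hpos : (0 : ℝ) < (((max N₁ 1 : ℕ) : ℝ)⁻¹) ^ 2 := by
      have : (0 : ℝ) < ((max N₁ 1 : ℕ) : ℝ) := by exact_mod_cast (by omega : 0 < max N₁ 1)
      positivity
    exact (mul_nonneg_iff_of_pos_right hpos).1 (measureReal_nonneg.trans h)
  -- the failure events
  set s : ℕ → Set (BondConfig (Site d)) := fun n =>
    {ω : BondConfig (Site d) | ∃ S : Finset (Site d), S ⊆ box d n ∧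
      (∀ x ∈ S, ∀ y ∈ S, ω ∈ openConnIn (↑S : Set (Site d)) x y) ∧
      c₃ * Real.log (n : ℝ) ^ ((d : ℝ) / ((d : ℝ) - 1)) ≤ (S.card : ℝ) ∧
      (openEdgeBoundaryCard d ω S : ℝ) < α * (S.card : ℝ) ^ (1 - 1 / (d : ℝ))} with hs
  -- a summable majorant and Borel–Cantelli
  set bmaj : ℕ → ℝ := fun n => (if n < N₁ then (1 : ℝ) else 0) + K * ((n : ℝ)⁻¹) ^ 2 with hbmaj
  have hbmaj0 : ∀ n, 0 ≤ bmaj n := fun n => by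
    rw [hbmaj]; positivity
  have hbsum : Summable bmaj := by
    refine Summable.add ?_ ?_
    · refine summable_of_ne_finset_zero (s := range N₁) fun n hn => ?_
      rw [mem_range] at hn
      simp [hn]
    · have h := (Real.summable_nat_pow_inv.2 one_lt_two).mul_left K
      refine h.congr fun n => ?_
      rw [inv_pow]
  have hle : ∀ n, μ (s n) ≤ ENNReal.ofReal (bmaj n) := by
    intro n
    by_cases hn : n < N₁
    · calc μ (s n) ≤ 1 := prob_le_one
        _ = ENNReal.ofReal 1 := ENNReal.ofReal_one.symm
        _ ≤ ENNReal.ofReal (bmaj n) := by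
            refine ENNReal.ofReal_le_ofReal ?_
            rw [hbmaj]; simp only [if_pos hn]
            have : 0 ≤ K * ((n : ℝ)⁻¹) ^ 2 := by positivity
            linarith
    · rw [← ofReal_measureReal (measure_ne_top _ _)]
      refine ENNReal.ofReal_le_ofReal ?_
      refine (hrate n (not_lt.1 hn)).trans ?_
      rw [hbmaj]; simp only [if_neg hn]; linarith
  have htsum : ∑' n, μ (s n) ≠ ∞ := by
    refine ne_top_of_le_ne_top ?_ (ENNReal.tsum_le_tsum hle)
    rw [← ENNReal.ofReal_tsum_of_nonneg hbmaj0 hbsum]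
    exact ENNReal.ofReal_ne_top
  have hae := ae_eventually_notMem htsum
  filter_upwards [hae] with ω hω
  obtain ⟨N₂, hN₂⟩ := eventually_atTop.1 hω
  refine ⟨N₂, fun n hn S hSbox _ hconn hsize => ?_⟩
  by_contra hlt
  push Not at hlt
  exact hN₂ n hn.le ⟨S, hSbox, hconn, hsize, hlt⟩

end Pete

/-- **Pete 2008, Corollary 1.3 — the named fact `Pete2008_cor13` DISCHARGED.** For `d ≥ 2` and
`p > p_c(ℤ^d)` there are `c₃, α > 0` such that a.s. eventually in `n` every open-connected
`S ⊆ 𝒞_∞ ∩ [-n,n]^d` with `|S| ≥ c₃ (log n)^{d/(d-1)}` has at least `α |S|^{1-1/d}` open boundary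
edges. [cite: Pete2008, Cor. 1.3] -/
theorem Pete2008_cor13_holds : Pete2008_cor13 := Pete.Pete2008_cor13_proof

end Literature.Probability.Percolation

end
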